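import Literature.NumberTheory.Rogawski1990.TransferFactsStabilisation
import Literature.NumberTheory.Rogawski1990.StabilisationPackageOfObsHasse
import Literature.NumberTheory.Rogawski1990.CartanObstructionSubgroup
import Literature.NumberTheory.Rogawski1990.CartanObsHasse
import HarnessLib

/-!
# The global transfer fact with the identity (4.3.3) `Δ_{G∕H}(γ_H, γ̄) = κ(obs γ̄)` FOR KOTTWITZ'S CONCRETE OBSTRUCTION `obs = cartanObs` — the RUNG-0 SWAP
# of the stabilisation package: Prop. 3.3.1 and the (5.4.5) bijection are THEOREMS in the tree, only [LanglandsShelstad1987, Thm. 6.4.B] stays printed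
# (ED. 5 of ★ `GlobalTransferWithFundamentalLemma[Canonical∕…StabilisationPackage]` under a NEW NAME, F5)

Topic `NumberTheory/Rogawski1990`; namespace `Literature.NumberTheory.Rogawski1990`.  ONE NAMED FACT `def … : Prop` (net debt **+1, declared** — it is the
rung-0 REPLACEMENT of ★ ED. 4 `GlobalTransferWithStabilisationPackage` as the antecedent the summit-side caller of the T1 line supplies: `hGT₄ :=
hGT₅.stabilisationPackage …`) + PROJECTIONS (theorems); no definition with data, no instance, no notation, no attribute, no `sorry`.  Imports ★ ED. 4
`TransferFactsStabilisation` (A-p06, p816075), ★ R7a `StabilisationPackageOfObsHasse` (F0P5a-p03 (g5), p816709: the dictionary `s`, the pinned bijection `e(γ₀)`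
and clause (a) from ANY obstruction with Prop. 3.3.1 in element form; transitively ★ `CartanIndex` (`cartanObsSubgroup`), ★ (KS-2b) `EndoscopicKappaBijection`) and
★ R6d (D) `CartanObstructionSubgroup` (F0P3a-p03: Kottwitz's obstruction `MatchingAdeleG₂.cartanObs hH hHd hreg : 𝒞′_𝐀(γ₀) → A(γ₀) = cartanObsSubgroup (cartanIndexCM …)`).
Cell pub/hodgecm-mathlib F0∕P3a, ENGINE T1; F0P5a-p03 (g5) TRUNK WORDS #2 (shape (α)), A-p06 (g20) pen.

WHY.  ★ ED. 4 carries, inside the `∃ Δ` of the global transfer fact, the per-regular-class package `∃ (A, 𝓡, obs, e), (a) Prop. 3.3.1 ∧ (c) (4.3.3)` as PRINTED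
data and clauses.  The G6 road has since made the DATA and clause (a) THEOREMS for Kottwitz's concrete obstruction: `A := A(γ₀) = cartanObsSubgroup (cartanIndex γ₀)`
(★ R6d-α, [Rogawski1990, §3.5 Prop. 3.5.2 (c) p. 29]), `obs := cartanObs` (★ R6d (D)), Prop. 3.3.1 `cartanObs p = 0 ↔ ∃ γ, p.IsRationalOver γ` (★ R7 ∕ R7b
`cartanObsFun_eq_zero_iff_exists_isRationalOver`, [§3.3 p. 22; Kottwitz1986 §9]), the (5.4.5) bijection `e(γ₀)` with its coordinate-sign pins and clause (a) in
character form (★ R7a `exists_endoscopicKappaEquiv_of_obsHasse`, [§5.4 pp. 73–74]).  What remains printed is clause (c) ALONE — the global transfer-factor identity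
(4.3.3) `Δ_𝐀(γ_H, γ̄) Δ_∞ = (e 𝒪H)(cartanObs γ̄)` for THE Langlands–Shelstad collection `Δ` [LanglandsShelstad1987, Thm. 6.4.A ∕ Cor. 6.4.B; Rogawski1990 (4.3.3) p. 44,
§14.3 p. 233].  This file states exactly that as the new antecedent (§1) and PROVES that it implies ★ ED. 4 (§2), so that at rung 0 row III-18 of the cell's books reads
«Prop. 4.9.1 (a)(b) with canonical measures + (4.3.3)∕[LS87 6.4.B] for Kottwitz's κ of `U(3)`» — Prop. 3.3.1 and (5.4.5) struck from the printed list.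
SHAPE (α) (F0P5a-p03 (g5)): clause (c) is asserted for EVERY pair `(s, e)` satisfying R7a's dictionary («`γ₀ − sndVal 𝒪H ∈ s 𝒪H`», image = the degree-one factors)
and pins (`e 𝒪H ε = (−1)^{ε (s 𝒪H)}`); such pairs form a SINGLETON (the τ-stable maximal ideal containing `γ₀ − u` is unique, ★ `maximalSpectrum_eq_of_matrixGen_sub_algebraMap_mem`;
the pins determine `e` from `s`), namely print's `𝒪H ↦ κ` of (5.4.5) — so the `∀` is print's statement with no `Classical.choose` in the fact.  As in ED. 4 the
package sits INSIDE the same `∃ (S_bad, Δ, m_H, m_G′)` (F0P3a-plan (g4) RULING #101 (Q3): (4.3.3) is a property OF the Langlands–Shelstad `Δ`, not of every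
collection with local transfer + FL + product formula) and is GUARDED by `H` anisotropic (the inner forms of the line; then every regular `γ₀` is elliptic) and
`γ₀` regular; `H` hermitian and `det H` a unit are harmless extra binders (Props) needed to NAME `cartanObs`.

* §1 **`GlobalTransferWithCartanKappaFormula L H Δ_∞ νH νG`** — the named fact (ED. 5).
* §2 **`GlobalTransferWithCartanKappaFormula.stabilisationPackage`** — ED. 5 ⇒ ★ ED. 4 `GlobalTransferWithStabilisationPackage`, given `H` hermitian and Prop. 3.3.1
  for `cartanObs` in element form (`hHasse`, = ★ R7 through (D)'s coercion — a hypothesis here so that this file does not pin R7's final name); `.canonical` (⇒ ED. 3).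
* §3 (ED. 2, append-only) **`GlobalTransferWithCartanKappaFormula.stabilisationPackage'`** — the same with `hHasse` DISCHARGED by ★ R7 `cartanObsHasse`
  (F0P5a-p03 (g5), p818237): ED. 5 ⇒ ★ ED. 4 given only `H′` hermitian — the rung-0 call is one token.

HONEST LABEL.  HC_CM is proved only modulo the printed citations until rung 0 closes; this fact is scheduled to ENTER that list in place of ★ ED. 4 when the
summit-side caller of `engineT1_of_stubs` is written (`hGT₄ := (hGT₅.stabilisationPackage hH cartanObsHasse)`), as «(4.3.3) for Kottwitz's κ» [LanglandsShelstad1987,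
Thm. 6.4.B].  Nothing in the tree proves it.

## References
* [Rogawski1990] J. D. Rogawski, *Automorphic Representations of Unitary Groups in Three Variables*, Ann. of Math. Stud. 123 (1990): §3.3 Prop. 3.3.1 p. 22;
  §3.5 Prop. 3.5.2 p. 29; §3.6 p. 31; §4.3 (4.3.1)–(4.3.3) pp. 43–44; §4.9 Prop. 4.9.1 p. 55; §5.4 (5.4.1)–(5.4.5) pp. 72–74; §14.3 pp. 233–234; §14.5 pp. 237–238.
* [LanglandsShelstad1987] R. P. Langlands, D. Shelstad, *On the definition of transfer factors*, Math. Ann. 278 (1987), §6.4 Thm. 6.4.A, Cor. 6.4.B.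
* [Kottwitz1986] R. E. Kottwitz, *Stable trace formula: elliptic singular terms*, Math. Ann. 275 (1986), §2.6, Prop. 7.1, §9.
-/

set_option autoImplicit false

noncomputable section

open MeasureTheory NumberField IsDedekindDomain
open Literature.MeasureTheory.Group
open scoped Matrix MatrixGroups

namespace Literature.NumberTheory.Rogawski1990

open Literature.NumberTheory.Automorphic
open Literature.AlgebraicGeometry.ShimuraVarieties (unitaryGroup hermForm)

/-! ## §1 The named fact: ED. 3 ∧ (4.3.3) for `cartanObs` and the pinned `e(γ₀)`, inside the same `∃ Δ` -/

section Global

variable (L : Type) [Field L] [NumberField L] [IsCMField L] (H' : Matrix (Fin 3) (Fin 3) L)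
  (Δinf : ↥(UnitaryGroup.arch (↥(maximalRealSubfield L)) L (IsCMField.complexConj L) 2
        (Matrix.of fun i j : Fin 2 => if i.val + j.val + 1 = 2 then (1 : L) else 0)) ×
      ↥(UnitaryGroup.arch (↥(maximalRealSubfield L)) L (IsCMField.complexConj L) 1
        (Matrix.of fun i j : Fin 1 => if i.val + j.val + 1 = 1 then (1 : L) else 0)) →
    ↥(UnitaryGroup.arch (↥(maximalRealSubfield L)) L (IsCMField.complexConj L) 3 H') → ℂ)


/-- **NAMED FACT (ED. 5 of ★ `GlobalTransferWithFundamentalLemma`, CANONICAL MEASURES + (4.3.3) FOR KOTTWITZ'S OBSTRUCTION) — ONE GLOBAL COLLECTION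
`(Δ_v, m_{H,v}, m_{G′,v})_v` CARRYING THE LOCAL TRANSFERS, THE UNIT FUNDAMENTAL LEMMA, THE PRODUCT FORMULA (★ ED. 3's body VERBATIM), AND, FOR THAT SAME `Δ`, AT
EVERY REGULAR `γ₀` OF THE ANISOTROPIC HERMITIAN `G′ = U(H′)`: for every dictionary `s : {𝒪H ↦ 𝒪_st(γ₀)} → cartanIndex γ₀` (injective, onto the degree-one τ-stable
factors of `L[γ₀]`, with `γ₀ − sndVal 𝒪H ∈ s 𝒪H`) and every bijection `e : {𝒪H ↦ 𝒪_st(γ₀)} ≃ {χ ∈ A(γ₀)^∨ ∣ χ ≠ 1}` pinned by `e(𝒪H)(ε) = (−1)^{ε(s 𝒪H)}` — print's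
(5.4.5) map «`{γ_H}_st ↦ κ`» [§5.4 pp. 73–74], a singleton of pairs — and every representative `γ_H → γ₀` of every transferring class, THE GLOBAL TRANSFER-FACTOR
IDENTITY ★ `GlobalKappaFormula L H′ Δ Δ_∞ (cartanObs ∘ toSelf) (e 𝒪H)`: `Δ_𝐀(γ_H, γ̄_f) · Δ_∞(γ_H ⊗ 1, γ̄_∞) = (e 𝒪H)(obs γ̄)` for every adèle `γ̄` matching `γ_H`,
`obs = ` ★ `MatchingAdeleG₂.cartanObs` = Kottwitz's `obs(γ̄) ∈ A(G_γ₀^d)` [§3.3 (3.3.1) p. 22; Kottwitz1986 §2.6, §9] realised on the τ-stable factors [Prop. 3.5.2 (c)].**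
HONEST RIDER (F0P3a-plan (g5) RULING #106 (1)): the `∀ (s, e)` under «dictionary + pins» ranges over print's SINGLETON `𝒪H ↦ κ` — the τ-stable maximal ideal of
`L[γ₀]` containing `γ₀ − sndVal 𝒪H` is unique (★ `maximalSpectrum_eq_of_matrixGen_sub_algebraMap_mem`) and the pins determine `e` from `s` — so clause (c) IS
(4.3.3) for Kottwitz's `κ`, and [LanglandsShelstad1987, Thm. 6.4.B ∕ Rogawski1990 (4.3.3)] is the ONLY printed content of this fact beyond ★ ED. 3 (Prop. 3.3.1 and
the (5.4.5) bijection are theorems: ★ R7∕R7b, ★ R7a).  Used as the rung-0 antecedent `hGT₅` (`hGT₄ := hGT₅.stabilisationPackage hH hHasse`); nothing in the tree proves it.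
[cite: Rogawski1990, §4.3 (4.3.3) pp. 43–44; §4.9 Prop. 4.9.1 (a), (b) p. 55; §5.4 (5.4.5) p. 73; §14.3 pp. 233–234] [cite: LanglandsShelstad1987, §6.4 Thm. 6.4.A, Cor. 6.4.B]
[cite: Kottwitz1986, §2.6, §9] -/
def GlobalTransferWithCartanKappaFormula
    [∀ v : HeightOneSpectrum (𝓞 ↥(maximalRealSubfield L)),
      MeasurableSpace ((UnitaryGroup.cmDatum L 2 (Matrix.of fun i j : Fin 2 => if i.val + j.val + 1 = 2 then (1 : L) else 0)).Local v ×
        (UnitaryGroup.cmDatum L 1 (Matrix.of fun i j : Fin 1 => if i.val + j.val + 1 = 1 then (1 : L) else 0)).Local v)]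
    [∀ v : HeightOneSpectrum (𝓞 ↥(maximalRealSubfield L)),
      BorelSpace ((UnitaryGroup.cmDatum L 2 (Matrix.of fun i j : Fin 2 => if i.val + j.val + 1 = 2 then (1 : L) else 0)).Local v ×
        (UnitaryGroup.cmDatum L 1 (Matrix.of fun i j : Fin 1 => if i.val + j.val + 1 = 1 then (1 : L) else 0)).Local v)]
    [∀ v : HeightOneSpectrum (𝓞 ↥(maximalRealSubfield L)), MeasurableSpace ((UnitaryGroup.cmDatum L 3 H').Local v)]
    [∀ v : HeightOneSpectrum (𝓞 ↥(maximalRealSubfield L)), BorelSpace ((UnitaryGroup.cmDatum L 3 H').Local v)]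
    (νH : ∀ v : HeightOneSpectrum (𝓞 ↥(maximalRealSubfield L)),
      Measure ((UnitaryGroup.cmDatum L 2 (Matrix.of fun i j : Fin 2 => if i.val + j.val + 1 = 2 then (1 : L) else 0)).Local v ×
        (UnitaryGroup.cmDatum L 1 (Matrix.of fun i j : Fin 1 => if i.val + j.val + 1 = 1 then (1 : L) else 0)).Local v))
    (νG : ∀ v : HeightOneSpectrum (𝓞 ↥(maximalRealSubfield L)), Measure ((UnitaryGroup.cmDatum L 3 H').Local v))
    [∀ v, IsFiniteMeasureOnCompacts (νH v)] [∀ v, (νH v).IsMulRightInvariant]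
    [∀ v, IsFiniteMeasureOnCompacts (νG v)] [∀ v, (νG v).IsMulRightInvariant] : Prop :=
  (∀ v : HeightOneSpectrum (𝓞 ↥(maximalRealSubfield L)),
      νG v (UnitaryGroup.cmLocalIntegralLevel L 3 H' v : Set ((UnitaryGroup.cmDatum L 3 H').Local v)) = 1) →
    (∀ v : HeightOneSpectrum (𝓞 ↥(maximalRealSubfield L)),
      νH v (((UnitaryGroup.cmLocalIntegralLevel L 2 (Matrix.of fun i j : Fin 2 => if i.val + j.val + 1 = 2 then (1 : L) else 0) v).prod
          (UnitaryGroup.cmLocalIntegralLevel L 1 (Matrix.of fun i j : Fin 1 => if i.val + j.val + 1 = 1 then (1 : L) else 0) v) :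
            Subgroup ((UnitaryGroup.cmDatum L 2 (Matrix.of fun i j : Fin 2 => if i.val + j.val + 1 = 2 then (1 : L) else 0)).Local v ×
              (UnitaryGroup.cmDatum L 1 (Matrix.of fun i j : Fin 1 => if i.val + j.val + 1 = 1 then (1 : L) else 0)).Local v)) :
          Set ((UnitaryGroup.cmDatum L 2 (Matrix.of fun i j : Fin 2 => if i.val + j.val + 1 = 2 then (1 : L) else 0)).Local v ×
            (UnitaryGroup.cmDatum L 1 (Matrix.of fun i j : Fin 1 => if i.val + j.val + 1 = 1 then (1 : L) else 0)).Local v)) = 1) →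
    letI : ∀ (v : HeightOneSpectrum (𝓞 ↥(maximalRealSubfield L)))
        (a : ((UnitaryGroup.cmDatum L 2 (Matrix.of fun i j : Fin 2 => if i.val + j.val + 1 = 2 then (1 : L) else 0)).Local v ×
          (UnitaryGroup.cmDatum L 1 (Matrix.of fun i j : Fin 1 => if i.val + j.val + 1 = 1 then (1 : L) else 0)).Local v)),
        MeasurableSpace (((UnitaryGroup.cmDatum L 2 (Matrix.of fun i j : Fin 2 => if i.val + j.val + 1 = 2 then (1 : L) else 0)).Local v ×
          (UnitaryGroup.cmDatum L 1 (Matrix.of fun i j : Fin 1 => if i.val + j.val + 1 = 1 then (1 : L) else 0)).Local v) ⧸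
          Subgroup.centralizer ({a} : Set ((UnitaryGroup.cmDatum L 2 (Matrix.of fun i j : Fin 2 => if i.val + j.val + 1 = 2 then (1 : L) else 0)).Local v ×
          (UnitaryGroup.cmDatum L 1 (Matrix.of fun i j : Fin 1 => if i.val + j.val + 1 = 1 then (1 : L) else 0)).Local v))) :=
      fun _ _ => borel _
    haveI : ∀ (v : HeightOneSpectrum (𝓞 ↥(maximalRealSubfield L)))
        (a : ((UnitaryGroup.cmDatum L 2 (Matrix.of fun i j : Fin 2 => if i.val + j.val + 1 = 2 then (1 : L) else 0)).Local v ×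
          (UnitaryGroup.cmDatum L 1 (Matrix.of fun i j : Fin 1 => if i.val + j.val + 1 = 1 then (1 : L) else 0)).Local v)),
        BorelSpace (((UnitaryGroup.cmDatum L 2 (Matrix.of fun i j : Fin 2 => if i.val + j.val + 1 = 2 then (1 : L) else 0)).Local v ×
          (UnitaryGroup.cmDatum L 1 (Matrix.of fun i j : Fin 1 => if i.val + j.val + 1 = 1 then (1 : L) else 0)).Local v) ⧸
          Subgroup.centralizer ({a} : Set ((UnitaryGroup.cmDatum L 2 (Matrix.of fun i j : Fin 2 => if i.val + j.val + 1 = 2 then (1 : L) else 0)).Local v ×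
          (UnitaryGroup.cmDatum L 1 (Matrix.of fun i j : Fin 1 => if i.val + j.val + 1 = 1 then (1 : L) else 0)).Local v))) :=
      fun _ _ => ⟨rfl⟩
    letI : ∀ (v : HeightOneSpectrum (𝓞 ↥(maximalRealSubfield L))) (γ : (UnitaryGroup.cmDatum L 3 H').Local v),
        MeasurableSpace ((UnitaryGroup.cmDatum L 3 H').Local v ⧸ Subgroup.centralizer ({γ} : Set ((UnitaryGroup.cmDatum L 3 H').Local v))) :=
      fun _ _ => borel _
    haveI : ∀ (v : HeightOneSpectrum (𝓞 ↥(maximalRealSubfield L))) (γ : (UnitaryGroup.cmDatum L 3 H').Local v),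
        BorelSpace ((UnitaryGroup.cmDatum L 3 H').Local v ⧸ Subgroup.centralizer ({γ} : Set ((UnitaryGroup.cmDatum L 3 H').Local v))) :=
      fun _ _ => ⟨rfl⟩
    ∃ (Sbad : Finset (HeightOneSpectrum (𝓞 ↥(maximalRealSubfield L))))
      (Δ : ∀ v : HeightOneSpectrum (𝓞 ↥(maximalRealSubfield L)), LocalTransferFactor L H' v)
      (mH : ∀ v : HeightOneSpectrum (𝓞 ↥(maximalRealSubfield L)),
        OrbitalMeasureFamily ((UnitaryGroup.cmDatum L 2 (Matrix.of fun i j : Fin 2 => if i.val + j.val + 1 = 2 then (1 : L) else 0)).Local v ×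
          (UnitaryGroup.cmDatum L 1 (Matrix.of fun i j : Fin 1 => if i.val + j.val + 1 = 1 then (1 : L) else 0)).Local v))
      (mG : ∀ v : HeightOneSpectrum (𝓞 ↥(maximalRealSubfield L)), OrbitalMeasureFamily ((UnitaryGroup.cmDatum L 3 H').Local v)),
      (∀ v, IsLocalTransferDatum L H' v (Δ v) (mH v) (mG v) ∧ (v ∉ Sbad → IsLocalUnitTransfer L H' v (Δ v) (mH v) (mG v)) ∧
          (mH v).IsCanonical (IsLocalGRegular L v) (νH v) ∧
          (mG v).IsCanonical (fun γ => IsRegularElt (γ.val : GL (Fin 3) (UnitaryGroup.LocalRing L v))) (νG v)) ∧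
        IsAlmostEverywhereTrivial L H' Δ ∧ SatisfiesProductFormula L H' Δ Δinf ∧
        ((∀ x : Fin 3 → L, hermForm (cmConjRingHom L) H' x x = 0 → x = 0) →
          ∀ (hH : (H'.map (cmConjRingHom L))ᵀ = H') (hHd : IsUnit H'.det)
            (γ₀ : (UnitaryGroup.cmDatum L 3 H').Rational) (hreg : IsRegularElt (γ₀.val : GL (Fin 3) L))
            [Fintype (cartanIndexCM hH hHd hreg)]
            (s : {𝒪H : StableClassH (cmConjRingHom L) (Matrix.of fun i j : Fin 2 => if i.val + j.val + 1 = 2 then (1 : L) else 0)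
                    (Matrix.of fun i j : Fin 1 => if i.val + j.val + 1 = 1 then (1 : L) else 0) //
                  𝒪H.TransfersTo H' endoForm_antidiagOne (stableClassOf (cmConjRingHom L) H' γ₀)} → cartanIndexCM hH hHd hreg)
            (e : {𝒪H : StableClassH (cmConjRingHom L) (Matrix.of fun i j : Fin 2 => if i.val + j.val + 1 = 2 then (1 : L) else 0)
                    (Matrix.of fun i j : Fin 1 => if i.val + j.val + 1 = 1 then (1 : L) else 0) //
                  𝒪H.TransfersTo H' endoForm_antidiagOne (stableClassOf (cmConjRingHom L) H' γ₀)} ≃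
                {χ : (⊤ : Subgroup (AddChar ↥(cartanObsSubgroup (cartanIndexCM hH hHd hreg)) ℂ)) // χ ≠ 1}),
            Function.Injective s →
            (∀ 𝔪 : cartanIndexCM hH hHd hreg, (∃ x, s x = 𝔪) ↔ Module.finrank L (↥(Algebra.adjoin L ({(((γ₀ : unitaryGroup (cmConjRingHom L) H').val : GL (Fin 3) L) : Matrix (Fin 3) (Fin 3) L)} :
                        Set (Matrix (Fin 3) (Fin 3) L))) ⧸ 𝔪.1.asIdeal) = 1) →
            (∀ x, (⟨(((γ₀ : unitaryGroup (cmConjRingHom L) H').val : GL (Fin 3) L) : Matrix (Fin 3) (Fin 3) L), Algebra.self_mem_adjoin_singleton L _⟩ :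
                    ↥(Algebra.adjoin L ({(((γ₀ : unitaryGroup (cmConjRingHom L) H').val : GL (Fin 3) L) : Matrix (Fin 3) (Fin 3) L)} :
                        Set (Matrix (Fin 3) (Fin 3) L)))) -
                algebraMap L _ x.1.sndVal ∈ (s x).1.asIdeal) →
            (∀ x (ε : ↥(cartanObsSubgroup (cartanIndexCM hH hHd hreg))),
                (((e x : (⊤ : Subgroup (AddChar ↥(cartanObsSubgroup (cartanIndexCM hH hHd hreg)) ℂ))) : AddChar ↥(cartanObsSubgroup (cartanIndexCM hH hHd hreg)) ℂ)) ε =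
                  (-1 : ℂ) ^ ((ε : cartanIndexCM hH hHd hreg → ZMod 2) (s x)).val) →
            ∀ (γH : (UnitaryGroup.cmDatum L 2 (Matrix.of fun i j : Fin 2 => if i.val + j.val + 1 = 2 then (1 : L) else 0)).Rational ×
                (UnitaryGroup.cmDatum L 1 (Matrix.of fun i j : Fin 1 => if i.val + j.val + 1 = 1 then (1 : L) else 0)).Rational)
              (hγ : IsNormPair L H' γH γ₀),
              GlobalKappaFormula L H' Δ Δinf
                (fun p : MatchingAdele L H' γH => MatchingAdeleG₂.cartanObs hH hHd hreg (MatchingAdele.toSelf hγ p))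
                (((e ⟨stableClassHOf (cmConjRingHom L) _ _ γH, hγ⟩).1 :
                    (⊤ : Subgroup (AddChar ↥(cartanObsSubgroup (cartanIndexCM hH hHd hreg)) ℂ))) : AddChar ↥(cartanObsSubgroup (cartanIndexCM hH hHd hreg)) ℂ))

variable {L H' Δinf}
variable
  [∀ v : HeightOneSpectrum (𝓞 ↥(maximalRealSubfield L)),
    MeasurableSpace ((UnitaryGroup.cmDatum L 2 (Matrix.of fun i j : Fin 2 => if i.val + j.val + 1 = 2 then (1 : L) else 0)).Local v ×
      (UnitaryGroup.cmDatum L 1 (Matrix.of fun i j : Fin 1 => if i.val + j.val + 1 = 1 then (1 : L) else 0)).Local v)]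
  [∀ v : HeightOneSpectrum (𝓞 ↥(maximalRealSubfield L)),
    BorelSpace ((UnitaryGroup.cmDatum L 2 (Matrix.of fun i j : Fin 2 => if i.val + j.val + 1 = 2 then (1 : L) else 0)).Local v ×
      (UnitaryGroup.cmDatum L 1 (Matrix.of fun i j : Fin 1 => if i.val + j.val + 1 = 1 then (1 : L) else 0)).Local v)]
  [∀ v : HeightOneSpectrum (𝓞 ↥(maximalRealSubfield L)), MeasurableSpace ((UnitaryGroup.cmDatum L 3 H').Local v)]
  [∀ v : HeightOneSpectrum (𝓞 ↥(maximalRealSubfield L)), BorelSpace ((UnitaryGroup.cmDatum L 3 H').Local v)]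
  {νH : ∀ v : HeightOneSpectrum (𝓞 ↥(maximalRealSubfield L)),
    Measure ((UnitaryGroup.cmDatum L 2 (Matrix.of fun i j : Fin 2 => if i.val + j.val + 1 = 2 then (1 : L) else 0)).Local v ×
      (UnitaryGroup.cmDatum L 1 (Matrix.of fun i j : Fin 1 => if i.val + j.val + 1 = 1 then (1 : L) else 0)).Local v)}
  {νG : ∀ v : HeightOneSpectrum (𝓞 ↥(maximalRealSubfield L)), Measure ((UnitaryGroup.cmDatum L 3 H').Local v)}
  [∀ v, IsFiniteMeasureOnCompacts (νH v)] [∀ v, (νH v).IsMulRightInvariant]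
  [∀ v, IsFiniteMeasureOnCompacts (νG v)] [∀ v, (νG v).IsMulRightInvariant]

/-! ## §2 ED. 5 ⇒ ED. 4 (the rung-0 swap), and ⇒ ED. 3 -/

/-- **Projection onto ED. 3**: forget the κ-clause — ★ `GlobalTransferWithFundamentalLemmaCanonical L H′ Δ_∞ νH νG`.
[cite: Rogawski1990, §4.9 Prop. 4.9.1 (a), (b) p. 55; §4.3 (4.3.3) p. 44] -/
theorem GlobalTransferWithCartanKappaFormula.canonical (h : GlobalTransferWithCartanKappaFormula L H' Δinf νH νG) :
    GlobalTransferWithFundamentalLemmaCanonical L H' Δinf νH νG := by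
  intro hKG hKH
  obtain ⟨Sbad, Δ, mH, mG, hloc, hae, hpf, -⟩ := h hKG hKH
  exact ⟨Sbad, Δ, mH, mG, hloc, hae, hpf⟩

/-- **THE RUNG-0 SWAP: ED. 5 ⇒ ★ ED. 4 `GlobalTransferWithStabilisationPackage`.**  For `H′` hermitian, given Prop. 3.3.1 for Kottwitz's obstruction in element
form (`hHasse : cartanObs p = 0 ↔ ∃ γ, p.IsRationalOver γ` — ★ R7 `cartanObsFun_eq_zero_iff_exists_isRationalOver` through (D)'s coercion; a hypothesis here),
the κ-clause for `cartanObs` implies the full per-class package of ED. 4 inside the same `∃ Δ`: at a regular `γ₀` of the anisotropic `U(H′)` take `A := A(γ₀)`,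
`𝓡 := ⊤`, `obs := cartanObs`, and `(s, e)` from ★ R7a `exists_endoscopicKappaEquiv_of_obsHasse` (which also delivers clause (a) in character form); clause (c) is
the fact's `∀ (s, e)` at that pair.  So the summit-side caller of the T1 line feeds `hGT₄ := hGT₅.stabilisationPackage hH hHasse`.
[cite: Rogawski1990, §3.3 Prop. 3.3.1 p. 22; §5.4 (5.4.5) p. 73; §4.3 (4.3.3) p. 44] [cite: Kottwitz1986, §9] [cite: LanglandsShelstad1987, §6.4 Cor. 6.4.B] -/
theorem GlobalTransferWithCartanKappaFormula.stabilisationPackage (h : GlobalTransferWithCartanKappaFormula L H' Δinf νH νG)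
    (hH : (H'.map (cmConjRingHom L))ᵀ = H')
    (hHasse : ∀ (hHd : IsUnit H'.det) (γ₀ : (UnitaryGroup.cmDatum L 3 H').Rational) (hreg : IsRegularElt (γ₀.val : GL (Fin 3) L))
      [Fintype (cartanIndexCM hH hHd hreg)] (p : MatchingAdeleG₂ L H' H' γ₀),
      MatchingAdeleG₂.cartanObs hH hHd hreg p = 0 ↔ ∃ γ, p.IsRationalOver γ) :
    GlobalTransferWithStabilisationPackage L H' Δinf νH νG := by
  intro hKG hKH
  obtain ⟨Sbad, Δ, mH, mG, hloc, hae, hpf, hpkg⟩ := h hKG hKH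
  refine ⟨Sbad, Δ, mH, mG, hloc, hae, hpf, fun hanis γ₀ hreg => ?_⟩
  have hHd : IsUnit H'.det := isUnit_iff_ne_zero.mpr (Godement.det_ne_zero_of_anisotropic L H' hanis)
  haveI : Finite (cartanIndexCM hH hHd hreg) :=
    finite_cartanIndex (cmConjRingHom L) (cmConjRingHom_algebraMap L) (IsCMField.complexConj_apply_apply L) hHd hH hreg
      (transpose_map_mul_mul_eq_of_rational γ₀)
  haveI : Fintype (cartanIndexCM hH hHd hreg) := Fintype.ofFinite _
  haveI : Fintype (⊤ : Subgroup (AddChar ↥(cartanObsSubgroup (cartanIndexCM hH hHd hreg)) ℂ)) := Fintype.ofFinite _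
  obtain ⟨s, e, hs, hrange, hdict, hpin, hchar⟩ :=
    MatchingAdeleG₂.exists_endoscopicKappaEquiv_of_obsHasse hH hHd hanis hreg (MatchingAdeleG₂.cartanObs hH hHd hreg) (hHasse hHd γ₀ hreg)
  exact ⟨_, inferInstance, ⊤, inferInstance, MatchingAdeleG₂.cartanObs hH hHd hreg, e, hchar,
    fun γH hγ => hpkg hanis hH hHd γ₀ hreg s e hs hrange hdict hpin γH hγ⟩

/-- **… and then ED. 2** (through ED. 4 ∕ ED. 3): under the normalisation guard, ★ `GlobalTransferWithFundamentalLemma L H′ Δ_∞`.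
[cite: Rogawski1990, §4.9 Prop. 4.9.1 (a), (b) p. 55; §14.6 pp. 242–243] -/
theorem GlobalTransferWithCartanKappaFormula.globalTransferWithFundamentalLemma (h : GlobalTransferWithCartanKappaFormula L H' Δinf νH νG)
    (hKG : ∀ v : HeightOneSpectrum (𝓞 ↥(maximalRealSubfield L)),
      νG v (UnitaryGroup.cmLocalIntegralLevel L 3 H' v : Set ((UnitaryGroup.cmDatum L 3 H').Local v)) = 1)
    (hKH : ∀ v : HeightOneSpectrum (𝓞 ↥(maximalRealSubfield L)),
      νH v (((UnitaryGroup.cmLocalIntegralLevel L 2 (Matrix.of fun i j : Fin 2 => if i.val + j.val + 1 = 2 then (1 : L) else 0) v).prod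
          (UnitaryGroup.cmLocalIntegralLevel L 1 (Matrix.of fun i j : Fin 1 => if i.val + j.val + 1 = 1 then (1 : L) else 0) v) :
            Subgroup ((UnitaryGroup.cmDatum L 2 (Matrix.of fun i j : Fin 2 => if i.val + j.val + 1 = 2 then (1 : L) else 0)).Local v ×
              (UnitaryGroup.cmDatum L 1 (Matrix.of fun i j : Fin 1 => if i.val + j.val + 1 = 1 then (1 : L) else 0)).Local v)) :
          Set ((UnitaryGroup.cmDatum L 2 (Matrix.of fun i j : Fin 2 => if i.val + j.val + 1 = 2 then (1 : L) else 0)).Local v ×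
            (UnitaryGroup.cmDatum L 1 (Matrix.of fun i j : Fin 1 => if i.val + j.val + 1 = 1 then (1 : L) else 0)).Local v)) = 1) :
    GlobalTransferWithFundamentalLemma L H' Δinf :=
  h.canonical.globalTransferWithFundamentalLemma hKG hKH

/-! ## §3 (ED. 2) The swap with Prop. 3.3.1 discharged in house -/

/-- **ED. 5 ⇒ ★ ED. 4 with NO residual hypothesis beyond `H′` hermitian**: Prop. 3.3.1 for Kottwitz's obstruction is ★ `cartanObsHasse` (the G6 road
R1–R7, BLUEPRINT 0a35b92f, kernel-closed), so the summit-side caller of the T1 line writes `hGT₄ := hGT₅.stabilisationPackage' hH`.  After this, the printed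
content of the line's transfer antecedent is «Prop. 4.9.1 (a)(b) with canonical measures + (4.3.3)∕[LS87 Thm 6.4.B] for Kottwitz's κ» and nothing else.
[cite: Rogawski1990, §3.3 Prop. 3.3.1 p. 22; §4.3 (4.3.3) p. 44; §5.4 (5.4.5) p. 73] [cite: Kottwitz1986, §9] [cite: LanglandsShelstad1987, §6.4 Cor. 6.4.B] -/
theorem GlobalTransferWithCartanKappaFormula.stabilisationPackage' (h : GlobalTransferWithCartanKappaFormula L H' Δinf νH νG)
    (hH : (H'.map (cmConjRingHom L))ᵀ = H') : GlobalTransferWithStabilisationPackage L H' Δinf νH νG :=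
  h.stabilisationPackage hH fun hHd _ hreg _ p => cartanObsHasse hH hHd hreg p

end Global

end Literature.NumberTheory.Rogawski1990

end
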